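import Summits.BirchSwinnertonDyer.BirchSwinnertonDyer.Theorems.PrintCf2SplitBadTwoRestrictedSelmerPairBase
import HarnessLib

/-!
# Crux `PrintCf2.SplitBadTwoRankOneOfFacts` (stmt-BirchSwinnertonDyer-20368), road α, stub S3c₂ — the BOTTOM VALUE of
# Agboola's reversed group `𝔖_{v̄}(K, M)`: THREE-FACTOR DECOMPOSITION (Agboola 2007 Prop. 6.11's snake lemma, `r = 1` shape)

Cell `bsd-print-cf2`, width seat `bsd-line-cf2-p1-w7` g2 (sequel of the B5 chain p648601 / p649193 / p649994 / p651541 /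
p652120 / p653109 of `-w7` g0); `--supports stmt-BirchSwinnertonDyer-20368` (helper, Theses-free). HONEST FRAMING: nothing here
closes a crux or a stub; BSD is not proved by any of this; no summit statement is proved by this seat. No definition, no named
fact, no `sorry`, no kit. beyond-print theorem: no (bookkeeping).

WHERE THIS SITS. The LEAD (g11/g12) reduced S3c₂ `stub_restrictedEulerCharBottom_two` to the four-index identity of `-w7` g0
(p652120) whose control terms are now class-bounded (kernel p656507, cokernel p658316 / p660499, `𝔖_Γ` under B17 p657357); what
remains displayed is the BOTTOM VALUE `v₂ #𝔖_{v̄}(K, W*)` — Agboola §6 / Prop. 8.1, «Poitou–Tate, XL». This file splits that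
bottom value, for ANY discrete `Γ_K`-module `M`, any `p` and any two finite places `v`, `v̄`, into THREE NAMED FACTORS, each of
which has an owner in the cell, so that the Poitou–Tate input can be displayed as ONE local statement and nothing else:

  `#𝔖_{v̄}(K, M) = #(Q ⊓ ker loc_{v̄}) · #((𝔖_v(K, M) ⊓ loc_{v̄}⁻¹ Q′) ⧸ Q) · #loc_v(𝔖_{v̄}(K, M))`
  (`natCard_restrictedSelmerBase_eq_three_mul`)

for every pair of subgroups `Q ≤ 𝔖_v(K, M) ⊆ H¹(K, M)` («global Kummer image of the summand»: for `M = W* = W[v̄^∞]` the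
classes of `W(K) ⊗ ℚ_p/ℤ_p` projected to `W*` ARE locally trivial away from `p`, strict at `v` — `W(K_v) ⊗_𝒪 D_{v̄} = 0`,
Agboola's «`E(K_{𝔭*}) ⊗ D_𝔭 = 0`» with the roles of the primes exchanged — and unconstrained at `v̄`, i.e. lie in the
Greenberg-shaped group `𝔖_v(K, W*)`) and `Q′ ≤ H¹(K_{v̄}, M)` («local Kummer image `W(K_{v̄}) ⊗ D_{v̄}`») with
`loc_{v̄}(Q) = Q′` (for `𝒪_K`-rank `r = 1` the localisation `W(K) ⊗ D_{v̄} → W(K_{v̄}) ⊗ D_{v̄}` is ONTO: both sides are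
divisible of corank one and the map is non-zero; Agboola's `E_{1,𝔭*}(K) = 0`). The three factors:
* `#(Q ⊓ ker loc_{v̄})` = Agboola's `|V| = [E(K_{𝔭*}) ⊗ 𝒪_{𝔭*} : loc_{𝔭*}(E(K) ⊗ 𝒪_{𝔭*})]`, the LOCAL INDEX AT `v̄` modulo
  torsion — by Prop. 8.1 `∼ p⁻¹ log_{E,𝔭*}(y_{𝔭*})`, at the additive prime `2` the dyadic brick B7 + the `ℚ`-generator `P`
  of S3c₂ (`2^{ℓ + e([d]₂)}`);
* `#((𝔖_v(K, M) ⊓ loc_{v̄}⁻¹ Q′) ⧸ Q)` = `#Ш(K)[M]` in `H¹(K, M)`-currency: `𝔖_v(K, M) ⊓ loc_{v̄}⁻¹ Q′` is the TRUE Selmer group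
  of the summand (strict at `v`, Kummer at `v̄`, trivial away from `p`) and `Q` its Kummer subgroup (the `-w8` B6 chain gives
  `#Ш(W_K)[𝔭̄^∞]` from `#Ш(W/ℚ)[2^∞]`: p648048 … CMShaInvariants);
* `#loc_v(𝔖_{v̄}(K, M))` = the image of Agboola's REVERSED group at the RELAXED place `v` — the ONE Poitou–Tate term: by global
  duality (Howard 2004 Thm. 2.1.11 with `𝓕 = str ≤ 𝓖 = 𝔖_{v̄}`, tree fact `poitouTate_selmerStructure_duality` at finite level)
  it is the exact annihilator of the image at `v` of the compact relaxed Selmer group of `T_v W = M^∨(1)`; Agboola Prop. 6.10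
  reads it as `[E(K_𝔭) ⊗ 𝒪_𝔭 : loc_𝔭(E(K) ⊗ 𝒪_𝔭)]` (Cassels' `B_n^∨ ≅ Sel(K, E_{πⁿ})`).

WHAT IS PROVED. §1 is pure group theory (abelian groups `A →loc B`, subgroups `Q ≤ G ≤ A`, `Q′ ≤ B`): the map
`G ⊓ ker loc → G ⧸ Q` has kernel `Q ⊓ ker loc` and is ONTO as soon as `loc(G) ⊆ loc(Q)` (`natCard_inf_ker_eq_mul_natCard_quotient`);
Agboola's printed form with the intermediate group `Ш_{rel(v)} = ker(G ⧸ Q → B ⧸ Q′)` (`map_mk_inf_ker_eq`,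
`natCard_inf_ker_eq_mul`). §2 instantiates at the bottom of the B5 pair (`Agboola2007.restrictedSelmerBase M p ·` inside
`H¹(Γ_K, M)`, local terms = the restrictions `loc_w = resOfLe M (⊤ ⊓ D_w ≤ ⊤)` of p649193): the doubly-strict group
`𝔖_v ⊓ 𝔖_{v̄}` is the true Selmer group cut by `ker loc_{v̄}` (`restrictedSelmerBase_inf_comap_inf_ker_eq`), whence
`#(𝔖_v ⊓ 𝔖_{v̄}) = #(Q ⊓ ker loc_{v̄}) · #Ш(K)[M]` (`natCard_restrictedSelmerBase_inf_eq_mul`) and, with p649193's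
`#𝔖_{v̄} = #(𝔖_v ⊓ 𝔖_{v̄}) · #loc_v(𝔖_{v̄})`, the three-factor identity and its `ord_p` form for finite `𝔖_{v̄}(K, M)`
(`finite_three_of_finite_restrictedSelmerBase`, `padicValNat_card_restrictedSelmerBase_eq_add_three`).

NOT PROVED HERE (said up front in the CLAIM on HOME/STATUS 2026-08-28): the instantiation of `Q`, `Q′` as the Kummer images of
the summand (tree `KummerMap.lean` / `kummerMapPInfty`, next file), the three VALUES (owners above), and `loc_{v̄}(Q) = Q′`
(rank bookkeeping). presearch: Agboola 2007 §6 (held, arXiv:math/0602192 p0013–p0015) IS the source; the snake is his (6.11);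
nothing new is claimed («presearch: bottom-value snake → [corpus:paper:arxiv-math_0602192 p0014–15] Prop. 6.11 verbatim»).

References: A. Agboola, Compositio Math. 143 (2007) 1374–1398 = arXiv:math/0602192, §6 Props. 6.10, 6.11, §8 Prop. 8.1
[Agboola2007]; B. Howard, Compositio Math. 140 (2004), Thm. 2.1.11 [Howard2004HeegnerKolyvagin]; R. Greenberg, LNM 1716 (1999),
§4 (proof of Thm. 4.1) [GreenbergLNM1716].
-/

noncomputable section

open scoped Classical

set_option linter.dupNamespace false
set_option autoImplicit false

open NumberField IsDedekindDomain Field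
open Literature.NumberTheory.EllipticCurves Literature.NumberTheory.EllipticCurves.GreenbergSelmer
open Literature.NumberTheory.EllipticCurves.Castella2018.AcSelmer
open Literature.NumberTheory.EllipticCurves.Agboola2007
open Literature.NumberTheory.GaloisRepresentations

universe u

namespace Summit.BirchSwinnertonDyer.BirchSwinnertonDyer.Theorems.PrintCf2.RestrictedSelmerPair

/-! ## §1. The snake of Agboola (6.11) as group theory: `G ⊓ ker loc → G ⧸ Q` -/

section Snake

variable {A B : Type*} [AddCommGroup A] [AddCommGroup B] (loc : A →+ B) (G Q : AddSubgroup A) (Q' : AddSubgroup B)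

/-- **Kernel of `G ⊓ ker loc → A ⧸ Q`**: the classes of the strict group `G ⊓ ker loc` that die modulo the «Kummer subgroup»
`Q` are exactly `Q ⊓ ker loc` (Agboola: the subgroup `V` of (6.11), the kernel of the localisation on `E(K) ⊗ D_{𝔭*}`).
[cite: Agboola2007, Prop. 6.11 (arXiv p0014:L60–p0015:L12)] -/
theorem ker_mk_comp_subtype_inf_ker :
    ((QuotientAddGroup.mk' Q).comp (G ⊓ loc.ker).subtype).ker = (Q ⊓ loc.ker).addSubgroupOf (G ⊓ loc.ker) := by
  ext x
  rw [AddMonoidHom.mem_ker, AddMonoidHom.comp_apply, AddSubgroup.coe_subtype, QuotientAddGroup.mk'_apply,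
    QuotientAddGroup.eq_zero_iff, AddSubgroup.mem_addSubgroupOf, AddSubgroup.mem_inf]
  exact ⟨fun h ↦ ⟨h, (AddSubgroup.mem_inf.1 x.2).2⟩, fun h ↦ h.1⟩

/-- **`G ⊓ ker loc → G ⧸ Q` is onto when `loc(G) ⊆ loc(Q)`**: every class of `G` has a representative killed by `loc`
(subtract an element of `Q` with the same localisation) — the vanishing of the cokernel of the localisation of (6.11) for
`𝒪_K`-rank `r ≥ 1` («`E(K_{𝔭*}) ⊗ D_{𝔭*}` is divisible of corank one»). [cite: Agboola2007, Prop. 6.11 (arXiv p0014:L60–80)] -/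
theorem range_mk_comp_subtype_inf_ker_eq (hQG : Q ≤ G) (hcov : G.map loc ≤ Q.map loc) :
    ((QuotientAddGroup.mk' Q).comp (G ⊓ loc.ker).subtype).range = G.map (QuotientAddGroup.mk' Q) := by
  rw [AddMonoidHom.range_comp, AddSubgroup.range_subtype]
  apply le_antisymm (AddSubgroup.map_mono inf_le_left)
  intro x hx
  obtain ⟨g, hg, rfl⟩ := AddSubgroup.mem_map.1 hx
  obtain ⟨q, hq, hqg⟩ := AddSubgroup.mem_map.1 (hcov (AddSubgroup.mem_map_of_mem loc hg))
  refine AddSubgroup.mem_map.2 ⟨g - q, AddSubgroup.mem_inf.2 ⟨G.sub_mem hg (hQG hq), ?_⟩, ?_⟩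
  · rw [AddMonoidHom.mem_ker, map_sub, hqg, sub_self]
  · rw [map_sub, QuotientAddGroup.mk'_apply, QuotientAddGroup.mk'_apply, (QuotientAddGroup.eq_zero_iff q).2 hq,
      sub_zero]

/-- **`#(G ⊓ ker loc) = #(Q ⊓ ker loc) · #(G ⧸ Q)`** for `Q ≤ G` with `loc(G) ⊆ loc(Q)` (first isomorphism theorem for
`G ⊓ ker loc → A ⧸ Q`; `Nat.card`, so both sides vanish together when a group is infinite): Agboola (6.11) with `E_{1,𝔭*} = 0`,
`|𝔖| = |V| · |Ш_{rel(𝔭)}|`. Here `#(G ⧸ Q)` is written as the order of the image `G.map mk ≤ A ⧸ Q`.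
[cite: Agboola2007, Prop. 6.11 (arXiv p0015:L1–12)] -/
theorem natCard_inf_ker_eq_mul_natCard_map (hQG : Q ≤ G) (hcov : G.map loc ≤ Q.map loc) :
    Nat.card ↥(G ⊓ loc.ker) = Nat.card ↥(Q ⊓ loc.ker) * Nat.card ↥(G.map (QuotientAddGroup.mk' Q)) := by
  set f := (QuotientAddGroup.mk' Q).comp (G ⊓ loc.ker).subtype with hf
  rw [AddSubgroup.card_eq_card_quotient_mul_card_addSubgroup f.ker,
    Nat.card_congr (QuotientAddGroup.quotientKerEquivRange f).toEquiv, hf,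
    range_mk_comp_subtype_inf_ker_eq loc G Q hQG hcov, ker_mk_comp_subtype_inf_ker,
    Nat.card_congr (AddSubgroup.addSubgroupOfEquivOfLe
      (inf_le_inf_right loc.ker hQG : Q ⊓ loc.ker ≤ G ⊓ loc.ker)).toEquiv, mul_comm]

/-- The same with the factor `#(G ⧸ Q)` written as a quotient: `#(G ⊓ ker loc) = #(Q ⊓ ker loc) · #(G ⧸ Q_G)`.
[cite: Agboola2007, Prop. 6.11 (arXiv p0015:L1–12)] -/
theorem natCard_inf_ker_eq_mul_natCard_quotient (hQG : Q ≤ G) (hcov : G.map loc ≤ Q.map loc) :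
    Nat.card ↥(G ⊓ loc.ker) = Nat.card ↥(Q ⊓ loc.ker) * Nat.card (G ⧸ Q.addSubgroupOf G) := by
  rw [natCard_inf_ker_eq_mul_natCard_map loc G Q hQG hcov]
  congr 1
  have hker : ((QuotientAddGroup.mk' Q).comp G.subtype).ker = Q.addSubgroupOf G := by
    ext x
    rw [AddMonoidHom.mem_ker, AddMonoidHom.comp_apply, AddSubgroup.coe_subtype, QuotientAddGroup.mk'_apply,
      QuotientAddGroup.eq_zero_iff, AddSubgroup.mem_addSubgroupOf]
  have hrange : ((QuotientAddGroup.mk' Q).comp G.subtype).range = G.map (QuotientAddGroup.mk' Q) := by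
    rw [AddMonoidHom.range_comp, AddSubgroup.range_subtype]
  rw [← hrange, ← Nat.card_congr (QuotientAddGroup.quotientKerEquivRange _).toEquiv, hker]

/-- **Agboola's intermediate group `Ш_{rel(v)}`, inclusion**: the image of the strict group `G ⊓ ker loc` in `A ⧸ Q` lies in
`ker (G ⧸ Q → B ⧸ Q′)` whenever `loc(Q) ⊆ Q′` (the right-hand column of the diagram of (6.11)).
[cite: Agboola2007, Prop. 6.11 (arXiv p0014:L81–p0015:L5)] -/
theorem map_mk_inf_ker_le (h : Q ≤ Q'.comap loc) :
    (G ⊓ loc.ker).map (QuotientAddGroup.mk' Q) ≤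
      G.map (QuotientAddGroup.mk' Q) ⊓ (QuotientAddGroup.map Q Q' loc h).ker := by
  intro x hx
  obtain ⟨g, hg, rfl⟩ := AddSubgroup.mem_map.1 hx
  obtain ⟨hgG, hgk⟩ := AddSubgroup.mem_inf.1 hg
  refine AddSubgroup.mem_inf.2 ⟨AddSubgroup.mem_map_of_mem _ hgG, ?_⟩
  rw [AddMonoidHom.mem_ker, QuotientAddGroup.map_mk', QuotientAddGroup.eq_zero_iff, AddMonoidHom.mem_ker.mp hgk]
  exact Q'.zero_mem

/-- **Agboola's intermediate group `Ш_{rel(v)}`, equality**: if moreover `Q ≤ G` and `Q′ ⊆ loc(Q)` (the localisation of the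
Kummer subgroup EXHAUSTS the local Kummer image — `r ≥ 1`), the image of `G ⊓ ker loc` in `A ⧸ Q` IS `ker (G ⧸ Q → B ⧸ Q′)`:
the snake of (6.11) is short exact. [cite: Agboola2007, Prop. 6.11 (arXiv p0015:L1–5)] -/
theorem map_mk_inf_ker_eq (h : Q ≤ Q'.comap loc) (hQG : Q ≤ G) (hsurj : Q' ≤ Q.map loc) :
    (G ⊓ loc.ker).map (QuotientAddGroup.mk' Q) =
      G.map (QuotientAddGroup.mk' Q) ⊓ (QuotientAddGroup.map Q Q' loc h).ker := by
  apply le_antisymm (map_mk_inf_ker_le loc G Q Q' h)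
  intro x hx
  obtain ⟨hx1, hx2⟩ := AddSubgroup.mem_inf.1 hx
  obtain ⟨g, hg, rfl⟩ := AddSubgroup.mem_map.1 hx1
  rw [AddMonoidHom.mem_ker, QuotientAddGroup.map_mk', QuotientAddGroup.eq_zero_iff] at hx2
  obtain ⟨q, hq, hqg⟩ := AddSubgroup.mem_map.1 (hsurj hx2)
  refine AddSubgroup.mem_map.2 ⟨g - q, AddSubgroup.mem_inf.2 ⟨G.sub_mem hg (hQG hq), ?_⟩, ?_⟩
  · rw [AddMonoidHom.mem_ker, map_sub, hqg, sub_self]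
  · rw [map_sub, QuotientAddGroup.mk'_apply, QuotientAddGroup.mk'_apply, (QuotientAddGroup.eq_zero_iff q).2 hq,
      sub_zero]

/-- **`#(G ⊓ ker loc) = #(Q ⊓ ker loc) · #Ш_{rel(v)}`**, `Ш_{rel(v)} = ker (G ⧸ Q → B ⧸ Q′)` — Agboola (6.11) in its printed
three-group form (`G = Sel_rel(K, W*)`, `Q = E(K) ⊗ D_{𝔭*}`, `Q′ = E(K_{𝔭*}) ⊗ D_{𝔭*}`, `B = H¹(K_{𝔭*}, W*)`,
`Ш_{rel(𝔭)}(K)(𝔭*) = ker (Ш_rel(K)(𝔭*) → H¹(K_{𝔭*}, E)(𝔭*))`). [cite: Agboola2007, Prop. 6.11 (arXiv p0014:L40–p0015:L12)] -/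
theorem natCard_inf_ker_eq_mul (h : Q ≤ Q'.comap loc) (hQG : Q ≤ G) (hsurj : Q' ≤ Q.map loc) :
    Nat.card ↥(G ⊓ loc.ker) =
      Nat.card ↥(Q ⊓ loc.ker) * Nat.card ↥(G.map (QuotientAddGroup.mk' Q) ⊓ (QuotientAddGroup.map Q Q' loc h).ker) := by
  set f := (QuotientAddGroup.mk' Q).comp (G ⊓ loc.ker).subtype with hf
  have hrange : f.range = G.map (QuotientAddGroup.mk' Q) ⊓ (QuotientAddGroup.map Q Q' loc h).ker := by
    rw [hf, AddMonoidHom.range_comp, AddSubgroup.range_subtype, map_mk_inf_ker_eq loc G Q Q' h hQG hsurj]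
  rw [AddSubgroup.card_eq_card_quotient_mul_card_addSubgroup f.ker,
    Nat.card_congr (QuotientAddGroup.quotientKerEquivRange f).toEquiv, hrange, hf, ker_mk_comp_subtype_inf_ker,
    Nat.card_congr (AddSubgroup.addSubgroupOfEquivOfLe
      (inf_le_inf_right loc.ker hQG : Q ⊓ loc.ker ≤ G ⊓ loc.ker)).toEquiv, mul_comm]

end Snake

/-! ## §2. At the bottom of the pair: `𝔖_{v̄}(K, M)` = local index at `v̄` × `Ш(K)[M]` × image at `v` -/

section Base

variable {K : Type u} [Field K] [NumberField K] (M : Type u) [AddCommGroup M]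
  [DistribMulAction (absoluteGaloisGroup K) M] [TopologicalSpace M] [DiscreteTopology M]
  (p : ℕ) (v vbar : HeightOneSpectrum (𝓞 K))
  (Q : AddSubgroup (subgroupH1 (⊤ : Subgroup (absoluteGaloisGroup K)) M))
  (Q' : AddSubgroup (subgroupH1 ((⊤ : Subgroup (absoluteGaloisGroup K)) ⊓ decomp vbar) M))

/-- **The true Selmer group of the summand cut by `ker loc_{v̄}` is the doubly-strict group**: for any «local Kummer image»
`Q′ ≤ H¹(K_{v̄}, M)`, `(𝔖_v(K, M) ⊓ loc_{v̄}⁻¹ Q′) ⊓ ker loc_{v̄} = 𝔖_v(K, M) ⊓ 𝔖_{v̄}(K, M)` (Agboola's `Sel_str(K, M)` for the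
split prime: strict above both places). [cite: Agboola2007, §3 (arXiv p0008:L50–56), §6] -/
theorem restrictedSelmerBase_inf_comap_inf_ker_eq :
    (restrictedSelmerBase M p v ⊓ Q'.comap (resOfLe M (inf_le_left : ⊤ ⊓ decomp vbar ≤ ⊤))) ⊓
        (resOfLe M (inf_le_left : ⊤ ⊓ decomp vbar ≤ ⊤)).ker =
      restrictedSelmerBase M p v ⊓ restrictedSelmerBase M p vbar := by
  rw [restrictedSelmerBase_inf_eq M p vbar v, inf_assoc]
  congr 1
  apply le_antisymm inf_le_right
  intro c hc
  refine AddSubgroup.mem_inf.2 ⟨?_, hc⟩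
  rw [AddSubgroup.mem_comap, AddMonoidHom.mem_ker.mp hc]
  exact Q'.zero_mem

/-- **`#(𝔖_v(K, M) ⊓ 𝔖_{v̄}(K, M)) = #(Q ⊓ ker loc_{v̄}) · #Ш(K)[M]`** — the doubly-strict group is the local index at `v̄`
(modulo torsion: `Q ⊓ ker loc_{v̄}`, Agboola's `V`) times the Tate–Shafarevich quotient
`Ш(K)[M] := (𝔖_v(K, M) ⊓ loc_{v̄}⁻¹ Q′) ⧸ Q` of the true Selmer group of the summand by its Kummer subgroup, for every `Q ≤ 𝔖_v(K, M)`
with `loc_{v̄}(Q) = Q′` (stated as the two inclusions). [cite: Agboola2007, Prop. 6.11 (arXiv p0014:L40–p0015:L12)] -/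
theorem natCard_restrictedSelmerBase_inf_eq_mul (hQ : Q ≤ restrictedSelmerBase M p v)
    (hQQ' : Q.map (resOfLe M (inf_le_left : ⊤ ⊓ decomp vbar ≤ ⊤)) ≤ Q')
    (hsurj : Q' ≤ Q.map (resOfLe M (inf_le_left : ⊤ ⊓ decomp vbar ≤ ⊤))) :
    Nat.card ↥(restrictedSelmerBase M p v ⊓ restrictedSelmerBase M p vbar) =
      Nat.card ↥(Q ⊓ (resOfLe M (inf_le_left : ⊤ ⊓ decomp vbar ≤ ⊤)).ker) *
        Nat.card (↥(restrictedSelmerBase M p v ⊓ Q'.comap (resOfLe M (inf_le_left : ⊤ ⊓ decomp vbar ≤ ⊤))) ⧸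
          Q.addSubgroupOf (restrictedSelmerBase M p v ⊓ Q'.comap (resOfLe M (inf_le_left : ⊤ ⊓ decomp vbar ≤ ⊤)))) := by
  rw [← restrictedSelmerBase_inf_comap_inf_ker_eq M p v vbar Q']
  refine natCard_inf_ker_eq_mul_natCard_quotient _ _ Q (le_inf hQ ?_) ?_
  · intro q hq
    exact (AddSubgroup.mem_comap).2 (hQQ' ⟨q, hq, rfl⟩)
  · rintro _ ⟨c, hc, rfl⟩
    exact hsurj ((AddSubgroup.mem_comap).1 hc.2)

/-- **THE THREE-FACTOR DECOMPOSITION OF THE BOTTOM VALUE.** For every discrete `Γ_K`-module `M`, every `p`, every two finite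
places `v`, `v̄`, every `Q ≤ 𝔖_v(K, M)` and `Q′ ≤ H¹(K_{v̄}, M)` with `loc_{v̄}(Q) = Q′`:
`#𝔖_{v̄}(K, M) = #(Q ⊓ ker loc_{v̄}) · #((𝔖_v(K, M) ⊓ loc_{v̄}⁻¹ Q′) ⧸ Q) · #loc_v(𝔖_{v̄}(K, M))` — LOCAL INDEX AT `v̄` × `Ш(K)[M]` ×
THE IMAGE OF THE REVERSED GROUP AT THE RELAXED PLACE (the Poitou–Tate term). For `M = W* = E[𝔭*^∞]`, `v = 𝔭`, `v̄ = 𝔭*`,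
`Q = E(K) ⊗ D_{𝔭*}`, `Q′ = E(K_{𝔭*}) ⊗ D_{𝔭*}` this is Agboola's `|𝔖_{𝔭*}(K, W*)| = |V| · |Ш(K)(𝔭*)| · [Ш_{rel(𝔭)}(K)(𝔭*) : Ш(K)(𝔭*)]`
(Props. 6.10–6.11; `Nat.card`, junk `0` when infinite). [cite: Agboola2007, Props. 6.10, 6.11 (arXiv p0014:L1–p0015:L12)] -/
theorem natCard_restrictedSelmerBase_eq_three_mul (hQ : Q ≤ restrictedSelmerBase M p v)
    (hQQ' : Q.map (resOfLe M (inf_le_left : ⊤ ⊓ decomp vbar ≤ ⊤)) ≤ Q')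
    (hsurj : Q' ≤ Q.map (resOfLe M (inf_le_left : ⊤ ⊓ decomp vbar ≤ ⊤))) :
    Nat.card (restrictedSelmerBase M p vbar) =
      Nat.card ↥(Q ⊓ (resOfLe M (inf_le_left : ⊤ ⊓ decomp vbar ≤ ⊤)).ker) *
        Nat.card (↥(restrictedSelmerBase M p v ⊓ Q'.comap (resOfLe M (inf_le_left : ⊤ ⊓ decomp vbar ≤ ⊤))) ⧸
          Q.addSubgroupOf (restrictedSelmerBase M p v ⊓ Q'.comap (resOfLe M (inf_le_left : ⊤ ⊓ decomp vbar ≤ ⊤)))) *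
        Nat.card ((resOfLe M (inf_le_left : ⊤ ⊓ decomp v ≤ ⊤)).comp (restrictedSelmerBase M p vbar).subtype).range := by
  rw [card_restrictedSelmerBase_eq M p v vbar, natCard_restrictedSelmerBase_inf_eq_mul M p v vbar Q Q' hQ hQQ' hsurj]

/-- **Finiteness of the three factors** when Agboola's reversed group `𝔖_{v̄}(K, M)` is finite (the `r = 1` world of S3c₂):
the local index `Q ⊓ ker loc_{v̄}`, the quotient `Ш(K)[M]` and the image `loc_v(𝔖_{v̄}(K, M))` are finite.
[cite: Agboola2007, Props. 6.5, 6.11 (arXiv p0014)] -/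
theorem finite_three_of_finite_restrictedSelmerBase [Finite (restrictedSelmerBase M p vbar)]
    (hQ : Q ≤ restrictedSelmerBase M p v)
    (hQQ' : Q.map (resOfLe M (inf_le_left : ⊤ ⊓ decomp vbar ≤ ⊤)) ≤ Q')
    (hsurj : Q' ≤ Q.map (resOfLe M (inf_le_left : ⊤ ⊓ decomp vbar ≤ ⊤))) :
    Finite ↥(Q ⊓ (resOfLe M (inf_le_left : ⊤ ⊓ decomp vbar ≤ ⊤)).ker) ∧
      Finite (↥(restrictedSelmerBase M p v ⊓ Q'.comap (resOfLe M (inf_le_left : ⊤ ⊓ decomp vbar ≤ ⊤))) ⧸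
          Q.addSubgroupOf (restrictedSelmerBase M p v ⊓ Q'.comap (resOfLe M (inf_le_left : ⊤ ⊓ decomp vbar ≤ ⊤)))) ∧
      Finite ((resOfLe M (inf_le_left : ⊤ ⊓ decomp v ≤ ⊤)).comp (restrictedSelmerBase M p vbar).subtype).range := by
  have h := natCard_restrictedSelmerBase_eq_three_mul M p v vbar Q Q' hQ hQQ' hsurj
  have hne : Nat.card (restrictedSelmerBase M p vbar) ≠ 0 := Nat.card_pos.ne'
  rw [h] at hne
  exact ⟨Nat.finite_of_card_ne_zero (left_ne_zero_of_mul (left_ne_zero_of_mul hne)),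
    Nat.finite_of_card_ne_zero (right_ne_zero_of_mul (left_ne_zero_of_mul hne)),
    Nat.finite_of_card_ne_zero (right_ne_zero_of_mul hne)⟩

/-- **`ord_p` FORM (the currency of S3c₂'s bottom value)**: when `𝔖_{v̄}(K, M)` is finite,
`ord_p #𝔖_{v̄}(K, M) = ord_p #(Q ⊓ ker loc_{v̄}) + ord_p #Ш(K)[M] + ord_p #loc_v(𝔖_{v̄}(K, M))` — the displayed «bottom value» of the
LEAD's S3c₂ assembly as the sum of the LOCAL INDEX at `v̄` (B7 / Prop. 8.1: `ℓ + e([d]₂)` on road α), the Ш-term (B6 chain) and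
the ONE Poitou–Tate term. [cite: Agboola2007, Thm. B via Props. 6.10, 6.11, 8.1 (arXiv p0017:L60–75)] -/
theorem padicValNat_card_restrictedSelmerBase_eq_add_three [Fact p.Prime] [Finite (restrictedSelmerBase M p vbar)]
    (hQ : Q ≤ restrictedSelmerBase M p v)
    (hQQ' : Q.map (resOfLe M (inf_le_left : ⊤ ⊓ decomp vbar ≤ ⊤)) ≤ Q')
    (hsurj : Q' ≤ Q.map (resOfLe M (inf_le_left : ⊤ ⊓ decomp vbar ≤ ⊤))) :
    padicValNat p (Nat.card (restrictedSelmerBase M p vbar)) =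
      padicValNat p (Nat.card ↥(Q ⊓ (resOfLe M (inf_le_left : ⊤ ⊓ decomp vbar ≤ ⊤)).ker)) +
        padicValNat p (Nat.card (↥(restrictedSelmerBase M p v ⊓ Q'.comap (resOfLe M (inf_le_left : ⊤ ⊓ decomp vbar ≤ ⊤))) ⧸
          Q.addSubgroupOf (restrictedSelmerBase M p v ⊓ Q'.comap (resOfLe M (inf_le_left : ⊤ ⊓ decomp vbar ≤ ⊤))))) +
        padicValNat p (Nat.card
          ((resOfLe M (inf_le_left : ⊤ ⊓ decomp v ≤ ⊤)).comp (restrictedSelmerBase M p vbar).subtype).range) := by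
  obtain ⟨h1, h2, h3⟩ := finite_three_of_finite_restrictedSelmerBase M p v vbar Q Q' hQ hQQ' hsurj
  rw [natCard_restrictedSelmerBase_eq_three_mul M p v vbar Q Q' hQ hQQ' hsurj,
    padicValNat.mul (mul_ne_zero Nat.card_pos.ne' Nat.card_pos.ne') Nat.card_pos.ne',
    padicValNat.mul Nat.card_pos.ne' Nat.card_pos.ne']

end Base

end Summit.BirchSwinnertonDyer.BirchSwinnertonDyer.Theorems.PrintCf2.RestrictedSelmerPair

end
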